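import Literature.AlgebraicGeometry.Resolution.BlowupSequencesExtensions
import Literature.AlgebraicGeometry.Resolution.MarkedIdealsRestrict
import HarnessLib

/-!
# The shape of a multiple blow-up off a subset: "the single blow-up of `J` off `Z`"

Topic: `Literature/AlgebraicGeometry/Resolution`. Bookkeeping for clause (ii) of
`BierstoneGrigorievMilmanWlodarczyk2011_canonical` / `HasShapedResolution`
(`CanonicalResolution.lean`, `CanonicalResolutionSpread.lean`; Bierstone–Grigoriev–Milman–
Włodarczyk 2011, Thm. 8.0.5 (2) with Def. 3.1.5 and Thm. 2.0.2 (2)–(3): "All centers `C_i` are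
disjoint from the set `Reg(Y) ⊂ Y_i` of points where `Y` (not `Y_i`) is smooth", and "in the
course of the principalization of `𝓘_Y`, the strict transform `Y_i` of `Y` in some `X_i` is the
center of a blow-up", §3.3 (2) ⇒ (3)). Clause (ii) says that the RESTRICTION `s|U` of the
resolution `s` to every open `U` missing the singular locus is an extension of the one-step
sequence blowing up `𝓘_Y|U` (`CentreSeq.IsExtensionOfSingle`). For the spreading-out argument
(`SpreadsShapedFromGenericPoint`) this has to be transported from the generic fibre of a family to
its special fibres, whose opens are unrelated; we therefore recast it as a property of `s` itself
relative to a subset `Z ⊆ X` (the singular locus) and an ideal sheaf `J` (the ideal of `Y`):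

* `EqOff C J Z` — the ideal sheaves `C` and `J` **agree off `Z`**: they have the same pull-back
  along every morphism whose image misses `Z` (`EqOff.of_comap_eq`: it suffices to check one open
  immersion covering `X ∖ Z`; `EqOff.comap`: stable under pull-back along ANY morphism).
* `CentreSeq.IsSingleOff s Z J` — **`s` is the single blow-up of `J` off `Z`**: some steps whose
  centres lie over `Z`, then ONE step whose centre agrees with (the pull-back of) `J` off (the
  preimage of) `Z`, then steps whose centres lie over `Z` (a recursive predicate in the style of
  `IsExtensionOfSingle`).
* `IsSingleOff.isExtensionOfSingle_restrict` — **if `s` is the single blow-up of `J` off `Z`, then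
  `s|U` is an extension of the one-step sequence along `J|U` for every open immersion `U → X`
  missing `Z`**; `isSingleOff_of_isExtensionOfSingle_restrict` — **conversely**, if `s|U` is such
  an extension for ONE open immersion `j : U → X`, then `s` is the single blow-up of `J` off
  `X ∖ j(U)`; `isSingleOff_compl_range_iff`.
* `IsSingleOff.comap` — the predicate is transported along the induced sequence `f^*(s)`
  (`CentreSeq.comap`) of ANY morphism `f : X' → X` (to `f⁻¹ Z`, `f^* J`) — the form in which it
  passes from a model over a base to the fibres; `IsSingleOff.mono` (in `Z`).

Supporting lemmas: `CentreSeq.CentresOver.comap` (centres over `T` pull back to centres over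
`f⁻¹ T` along any morphism), `CentresOver.allTrivial_restrict` /
`centresOver_of_allTrivial_restrict` (the restriction to an open missing `T` is trivial iff the
centres lie over the complement of the open), `comap_eq_top_of_support_subset`.

Everything here is elementary bookkeeping on `CentreSeq` (no geometry beyond
`blowup.range_map`: `Bl(j)` has image `π⁻¹(j(U))`); all statements are PROVED.

## Sources

* E. Bierstone, D. Grigoriev, P. Milman, J. Włodarczyk, *Effective Hironaka resolution and its
  complexity*, Asian J. Math. 15 (2011) 193–228 = arXiv:1206.3090: Thm. 2.0.2 (2)–(3) (p. 5),
  Def. 3.1.5 with Remark (1) (p. 6), §3.3 (2) ⇒ (3) (p. 7), Thm. 8.0.5 (2) (p. 23).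
  [BierstoneGrigorievMilmanWlodarczyk2011]
-/

noncomputable section

open CategoryTheory CategoryTheory.Limits AlgebraicGeometry TopologicalSpace Topology

namespace Literature.AlgebraicGeometry.Resolution

universe u

variable {X : Scheme.{u}}

/-! ## Ideal sheaves agreeing off a subset -/

/-- **`C` and `J` agree off `Z`**: the pull-backs of the ideal sheaves `C` and `J` along every
morphism `g : V → X` whose image misses `Z` coincide (for `Z` closed: `C|_{X ∖ Z} = J|_{X ∖ Z}`,
`EqOff.of_comap_eq`; the universal form is stable under arbitrary pull-back, `EqOff.comap`).
[folklore] -/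
def EqOff (C J : X.IdealSheafData) (Z : Set X) : Prop :=
  ∀ ⦃V : Scheme.{u}⦄ (g : V ⟶ X), Set.range g ⊆ Zᶜ → C.comap g = J.comap g

namespace EqOff

/-- Reflexivity. [folklore] -/
theorem refl (C : X.IdealSheafData) (Z : Set X) : EqOff C C Z := fun _ _ _ => rfl

/-- Symmetry. [folklore] -/
theorem symm {C J : X.IdealSheafData} {Z : Set X} (h : EqOff C J Z) : EqOff J C Z :=
  fun _ g hg => (h g hg).symm

/-- Transitivity. [folklore] -/
theorem trans {C J K : X.IdealSheafData} {Z : Set X} (h : EqOff C J Z) (h' : EqOff J K Z) :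
    EqOff C K Z :=
  fun _ g hg => (h g hg).trans (h' g hg)

/-- Monotonicity in the exceptional subset. [folklore] -/
theorem mono {C J : X.IdealSheafData} {Z Z' : Set X} (hZ : Z ⊆ Z') (h : EqOff C J Z) :
    EqOff C J Z' :=
  fun _ g hg => h g (hg.trans (Set.compl_subset_compl.mpr hZ))

/-- The defining property, as a lemma. [folklore] -/
theorem comap_eq {C J : X.IdealSheafData} {Z : Set X} (h : EqOff C J Z) {V : Scheme.{u}}
    (g : V ⟶ X) (hg : Set.range g ⊆ Zᶜ) : C.comap g = J.comap g :=
  h g hg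

/-- **One open immersion covering `X ∖ Z` suffices**: if `C|_U = J|_U` along an open immersion
`j : U → X` with `X ∖ Z ⊆ j(U)`, then `C` and `J` agree off `Z` (every morphism missing `Z`
factors through `j`, `IsOpenImmersion.lift`). [folklore] -/
theorem of_comap_eq {U : Scheme.{u}} (j : U ⟶ X) [IsOpenImmersion j] {C J : X.IdealSheafData}
    (h : C.comap j = J.comap j) {Z : Set X} (hZ : Zᶜ ⊆ Set.range j) : EqOff C J Z := by
  intro V g hg
  rw [← IsOpenImmersion.lift_fac j g (hg.trans hZ), Scheme.IdealSheafData.comap_comp,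
    Scheme.IdealSheafData.comap_comp, h]

/-- **Stability under pull-back along any morphism** `f : X' → X`: `f^*C` and `f^*J` agree off
`f⁻¹ Z`. [folklore] -/
theorem comap {C J : X.IdealSheafData} {Z : Set X} (h : EqOff C J Z) {X' : Scheme.{u}}
    (f : X' ⟶ X) : EqOff (C.comap f) (J.comap f) (f ⁻¹' Z) := by
  intro V g hg
  rw [← Scheme.IdealSheafData.comap_comp, ← Scheme.IdealSheafData.comap_comp]
  refine h (g ≫ f) ?_
  rintro _ ⟨v, rfl⟩ hv
  exact hg ⟨v, rfl⟩ (by simpa using hv)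

end EqOff

/-- A centre lying over `Z` pulls back to the unit ideal sheaf (the empty centre) along every
morphism missing `Z`. [folklore] -/
theorem comap_eq_top_of_support_subset {C : X.IdealSheafData} {Z : Set X}
    (hC : (C.support : Set X) ⊆ Z) {V : Scheme.{u}} (g : V ⟶ X) (hg : Set.range g ⊆ Zᶜ) :
    C.comap g = ⊤ := by
  rw [← Scheme.IdealSheafData.support_eq_bot_iff]
  refine le_bot_iff.mp fun v hv => ?_
  rw [Scheme.IdealSheafData.support_comap] at hv
  exact hg ⟨v, rfl⟩ (hC hv)

namespace CentreSeq

/-! ## Centres over a subset: pull-back, and triviality of restrictions -/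

/-- Centres over `T` pull back, along ANY morphism `f`, to centres over `f⁻¹ T` (the induced
sequence `CentreSeq.comap`; cf. `CentresOver.restrict` for open immersions). [folklore] -/
theorem CentresOver.comap : ∀ {X U : Scheme.{u}} (s : CentreSeq X) (f : U ⟶ X) {T : Set X},
    s.CentresOver T → (s.comap f).CentresOver (f ⁻¹' T)
  | _, _, nil _, _, _, _ => trivial
  | _, U, cons C rest, f, T, h => by
    obtain ⟨hC, hrest⟩ := h
    refine (centresOver_cons (C.comap f) _ _).mpr ⟨?_, ?_⟩
    · intro u hu
      rw [Scheme.IdealSheafData.support_comap] at hu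
      exact hC hu
    · have ih := CentresOver.comap rest (blowup.comapMap C f) hrest
      have e : blowup.comapMap C f ⁻¹' (blowup.π C ⁻¹' T) =
          blowup.π (C.comap f) ⁻¹' (f ⁻¹' T) := by
        rw [← Set.preimage_comp, ← Set.preimage_comp, ← TopCat.coe_comp, ← TopCat.coe_comp,
          ← Scheme.Hom.comp_base, ← Scheme.Hom.comp_base, blowup.comapMap_π]
      rwa [e] at ih

/-- **A sequence with centres over `T` is trivial over every open missing `T`.** [folklore] -/
theorem CentresOver.allTrivial_restrict {s : CentreSeq X} {T : Set X} (h : s.CentresOver T)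
    {U : Scheme.{u}} (j : U ⟶ X) [IsOpenImmersion j] (hj : Set.range j ⊆ Tᶜ) :
    (s.restrict j).AllTrivial := by
  refine CentresOver.allTrivial_of_empty _ ?_
  have he : j ⁻¹' T = ∅ := Set.subset_empty_iff.mp fun u hu => (hj ⟨u, rfl⟩ hu).elim
  simpa only [he] using CentresOver.restrict s j h

/-- **Conversely, a sequence trivial over the open `j(U)` has its centres over `X ∖ j(U)`.**
[folklore] -/
theorem centresOver_of_allTrivial_restrict : ∀ {X U : Scheme.{u}} (s : CentreSeq X) (j : U ⟶ X)
    [IsOpenImmersion j], (s.restrict j).AllTrivial → s.CentresOver (Set.range j)ᶜ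
  | _, _, nil _, _, _, _ => trivial
  | _, U, cons C rest, j, _, h => by
    obtain ⟨hC, hrest⟩ := h
    refine (centresOver_cons C rest _).mpr ⟨?_, ?_⟩
    · rintro x hx ⟨u, rfl⟩
      have hu : u ∈ (C.comap j).support := by
        rw [Scheme.IdealSheafData.support_comap]
        exact hx
      rw [hC, Scheme.IdealSheafData.support_top] at hu
      exact hu
    · have ih := centresOver_of_allTrivial_restrict rest (blowup.map C j) hrest
      rwa [blowup.range_map, ← Set.preimage_compl] at ih

/-! ## The single blow-up of `J` off `Z` -/

/-- **`s` is, off `Z`, the single blow-up of `J`** (the content of BGMW Thm. 2.0.2 (2)–(3) /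
Thm. 8.0.5 (2) for the opens missing the singular locus `Z` of `Y = V(J)`: "All centers `C_i` are
disjoint from the set `Reg(Y) ⊂ Y_i`" except the one blowing up the strict transform of `Y`,
which over `X ∖ Z` is `Y` itself): a number of steps whose centres lie over `Z`, then ONE step
whose centre agrees with the pull-back of `J` off the preimage of `Z` (`EqOff`), then steps whose
centres lie over (the preimage of) `Z` (`CentresOver`).
[cite: BierstoneGrigorievMilmanWlodarczyk2011, Thm. 2.0.2 (2)–(3) with Def. 3.1.5 and §3.3 (2)⇒(3)] -/
def IsSingleOff : {X : Scheme.{u}} → CentreSeq X → Set X → X.IdealSheafData → Prop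
  | _, nil _, _, _ => False
  | _, cons C rest, Z, J =>
      ((C.support : Set _) ⊆ Z ∧ IsSingleOff rest (blowup.π C ⁻¹' Z) (J.comap (blowup.π C))) ∨
        (EqOff C J Z ∧ rest.CentresOver (blowup.π C ⁻¹' Z))

/-- Unfolding: the empty sequence is not a single blow-up off anything. [folklore] -/
@[simp] theorem not_isSingleOff_nil (Z : Set X) (J : X.IdealSheafData) :
    ¬ (nil X).IsSingleOff Z J := fun h => h

/-- Unfolding. [folklore] -/
theorem isSingleOff_cons (C : X.IdealSheafData) (rest : CentreSeq (blowup C)) (Z : Set X)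
    (J : X.IdealSheafData) :
    (cons C rest).IsSingleOff Z J ↔
      ((C.support : Set X) ⊆ Z ∧ rest.IsSingleOff (blowup.π C ⁻¹' Z) (J.comap (blowup.π C))) ∨
        (EqOff C J Z ∧ rest.CentresOver (blowup.π C ⁻¹' Z)) :=
  Iff.rfl

/-- Non-vacuity: the one-step sequence along `J` is the single blow-up of `J` off every `Z`.
[folklore] -/
@[simp] theorem isSingleOff_single (J : X.IdealSheafData) (Z : Set X) :
    (single J).IsSingleOff Z J :=
  Or.inr ⟨EqOff.refl J Z, trivial⟩

/-- Matching the `J`-step. [folklore] -/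
theorem IsSingleOff.cons_eqOff {C J : X.IdealSheafData} {Z : Set X} (hCJ : EqOff C J Z)
    {rest : CentreSeq (blowup C)} (hrest : rest.CentresOver (blowup.π C ⁻¹' Z)) :
    (cons C rest).IsSingleOff Z J :=
  Or.inr ⟨hCJ, hrest⟩

/-- Prepending a step whose centre lies over `Z`. [folklore] -/
theorem IsSingleOff.cons_over {C J : X.IdealSheafData} {Z : Set X} (hC : (C.support : Set X) ⊆ Z)
    {rest : CentreSeq (blowup C)}
    (hrest : rest.IsSingleOff (blowup.π C ⁻¹' Z) (J.comap (blowup.π C))) :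
    (cons C rest).IsSingleOff Z J :=
  Or.inl ⟨hC, hrest⟩

/-- A single blow-up off `Z` is a non-empty sequence. [folklore] -/
theorem IsSingleOff.length_pos : ∀ {X : Scheme.{u}} {s : CentreSeq X} {Z : Set X}
    {J : X.IdealSheafData}, s.IsSingleOff Z J → 0 < s.length
  | _, nil _, _, _, h => (h : False).elim
  | _, cons _ _, _, _, _ => Nat.succ_pos _

/-- **Monotonicity in `Z`.** [folklore] -/
theorem IsSingleOff.mono : ∀ {X : Scheme.{u}} {s : CentreSeq X} {Z Z' : Set X}
    {J : X.IdealSheafData}, Z ⊆ Z' → s.IsSingleOff Z J → s.IsSingleOff Z' J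
  | _, nil _, _, _, _, _, h => (h : False).elim
  | _, cons C rest, Z, Z', J, hZ, h => by
    rcases h with ⟨hC, hrest⟩ | ⟨hCJ, hrest⟩
    · exact Or.inl ⟨hC.trans hZ, IsSingleOff.mono (Set.preimage_mono hZ) hrest⟩
    · exact Or.inr ⟨hCJ.mono hZ, CentresOver.mono rest (Set.preimage_mono hZ) hrest⟩

/-- **Transport along the induced sequence of ANY morphism** `f : X' → X` (e.g. the inclusion of
a fibre of a family): if `s` is the single blow-up of `J` off `Z`, then `f^*(s)` is the single
blow-up of `f^*J` off `f⁻¹ Z`. [cite: BierstoneGrigorievMilmanWlodarczyk2011, Thm. 8.0.5 (2) with Def. 3.1.5 Remark (1)] -/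
theorem IsSingleOff.comap : ∀ {X X' : Scheme.{u}} {s : CentreSeq X} {Z : Set X}
    {J : X.IdealSheafData} (f : X' ⟶ X),
    s.IsSingleOff Z J → (s.comap f).IsSingleOff (f ⁻¹' Z) (J.comap f)
  | _, _, nil _, _, _, _, h => (h : False).elim
  | _, X', cons C rest, Z, J, f, h => by
    have e : ∀ T : Set _, blowup.comapMap C f ⁻¹' (blowup.π C ⁻¹' T) =
        blowup.π (C.comap f) ⁻¹' (f ⁻¹' T) := fun T => by
      rw [← Set.preimage_comp, ← Set.preimage_comp, ← TopCat.coe_comp, ← TopCat.coe_comp,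
        ← Scheme.Hom.comp_base, ← Scheme.Hom.comp_base, blowup.comapMap_π]
    rcases h with ⟨hC, hrest⟩ | ⟨hCJ, hrest⟩
    · refine Or.inl ⟨?_, ?_⟩
      · intro x hx
        rw [Scheme.IdealSheafData.support_comap] at hx
        exact hC hx
      · have ih := IsSingleOff.comap (blowup.comapMap C f) hrest
        rw [e, ← Scheme.IdealSheafData.comap_comp, blowup.comapMap_π,
          Scheme.IdealSheafData.comap_comp] at ih
        exact ih
    · refine Or.inr ⟨hCJ.comap f, ?_⟩
      have ih := CentresOver.comap rest (blowup.comapMap C f) hrest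
      rwa [e] at ih

/-- **The single blow-up of `J` off `Z` restricts, over every open missing `Z`, to an extension
of the one-step sequence along `J`** (BGMW Def. 3.1.5: the steps over `Z` restrict to trivial
steps — centre `⊤`, an isomorphism —, the `J`-step to the blow-up of `J|U`).
[cite: BierstoneGrigorievMilmanWlodarczyk2011, Thm. 8.0.5 (2) with Def. 3.1.5 and Remark (1)] -/
theorem IsSingleOff.isExtensionOfSingle_restrict : ∀ {X U : Scheme.{u}} {s : CentreSeq X}
    {Z : Set X} {J : X.IdealSheafData} (j : U ⟶ X) [IsOpenImmersion j], Set.range j ⊆ Zᶜ →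
    s.IsSingleOff Z J → (s.restrict j).IsExtensionOfSingle (J.comap j)
  | _, _, nil _, _, _, _, _, _, h => (h : False).elim
  | _, U, cons C rest, Z, J, j, _, hj, h => by
    have hrange : Set.range (blowup.map C j) ⊆ (blowup.π C ⁻¹' Z)ᶜ := by
      rw [blowup.range_map, ← Set.preimage_compl]
      exact Set.preimage_mono hj
    rcases h with ⟨hC, hrest⟩ | ⟨hCJ, hrest⟩
    · refine Or.inr ⟨comap_eq_top_of_support_subset hC j hj, ?_⟩
      have ih := IsSingleOff.isExtensionOfSingle_restrict (blowup.map C j) hrange hrest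
      rw [← Scheme.IdealSheafData.comap_comp, blowup.map_π, Scheme.IdealSheafData.comap_comp]
        at ih
      exact ih
    · exact Or.inl ⟨hCJ j hj, hrest.allTrivial_restrict (blowup.map C j) hrange⟩

/-- **Conversely: if `s|U` is an extension of the one-step sequence along `J|U` for ONE open
immersion `j : U → X`, then `s` is the single blow-up of `J` off `X ∖ j(U)`** (the extraction of
the shape of the resolution from clause (ii) applied to `U = X ∖ Sing(Y)`).
[cite: BierstoneGrigorievMilmanWlodarczyk2011, Thm. 2.0.2 (2)–(3) via Thm. 8.0.5 (2)] -/
theorem isSingleOff_of_isExtensionOfSingle_restrict : ∀ {X U : Scheme.{u}} (s : CentreSeq X)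
    (J : X.IdealSheafData) (j : U ⟶ X) [IsOpenImmersion j],
    (s.restrict j).IsExtensionOfSingle (J.comap j) → s.IsSingleOff (Set.range j)ᶜ J
  | _, _, nil _, _, _, _, h => (h : False).elim
  | _, U, cons C rest, J, j, _, h => by
    have hrange : (Set.range (blowup.map C j))ᶜ = blowup.π C ⁻¹' (Set.range j)ᶜ := by
      rw [blowup.range_map, Set.preimage_compl]
    rcases h with ⟨hCJ, hrest⟩ | ⟨hC, hrest⟩
    · refine Or.inr ⟨EqOff.of_comap_eq j hCJ (by rw [compl_compl]), ?_⟩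
      rw [← hrange]
      exact centresOver_of_allTrivial_restrict rest (blowup.map C j) hrest
    · refine Or.inl ⟨?_, ?_⟩
      · rintro x hx ⟨u, rfl⟩
        have hu : u ∈ (C.comap j).support := by
          rw [Scheme.IdealSheafData.support_comap]
          exact hx
        rw [hC, Scheme.IdealSheafData.support_top] at hu
        exact hu
      · rw [← Scheme.IdealSheafData.comap_comp, ← blowup.map_π, Scheme.IdealSheafData.comap_comp]
          at hrest
        have ih := isSingleOff_of_isExtensionOfSingle_restrict rest (J.comap (blowup.π C))
          (blowup.map C j) hrest
        rwa [hrange] at ih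

/-- **`s` is the single blow-up of `J` off `X ∖ j(U)` iff `s|U` is an extension of the one-step
sequence along `J|U`.** [cite: BierstoneGrigorievMilmanWlodarczyk2011, Thm. 8.0.5 (2) with Def. 3.1.5] -/
theorem isSingleOff_compl_range_iff {U : Scheme.{u}} (s : CentreSeq X) (J : X.IdealSheafData)
    (j : U ⟶ X) [IsOpenImmersion j] :
    s.IsSingleOff (Set.range j)ᶜ J ↔ (s.restrict j).IsExtensionOfSingle (J.comap j) :=
  ⟨fun h => h.isExtensionOfSingle_restrict j (by rw [compl_compl]),
    isSingleOff_of_isExtensionOfSingle_restrict s J j⟩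

/-- **The fibre form of clause (ii).** If `s` is the single blow-up of `J` off `Z` and
`f : X' → X` is any morphism (the inclusion of a fibre), then for every open immersion
`j : U → X'` whose image misses `f⁻¹ Z`, the restriction `(f^*s)|U` is an extension of the
one-step sequence along `(f^*J)|U`.
[cite: BierstoneGrigorievMilmanWlodarczyk2011, Thm. 8.0.5 (2) with Def. 3.1.5 Remark (1)] -/
theorem IsSingleOff.isExtensionOfSingle_restrict_comap {X' U : Scheme.{u}} {s : CentreSeq X}
    {Z : Set X} {J : X.IdealSheafData} (h : s.IsSingleOff Z J) (f : X' ⟶ X) (j : U ⟶ X')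
    [IsOpenImmersion j] (hj : Set.range j ⊆ (f ⁻¹' Z)ᶜ) :
    ((s.comap f).restrict j).IsExtensionOfSingle ((J.comap f).comap j) :=
  (h.comap f).isExtensionOfSingle_restrict j hj

end CentreSeq

end Literature.AlgebraicGeometry.Resolution

end
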